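import Summits.ResolutionOfSingularities.ResolutionOfSingularities.Theorems.WeightedInvariantHypersurfaceCentreChoiceToDatum
import HarnessLib

/-!
# The ∃-form of the door: finite ADMISSIBLE centre sequences ending in a regular strict transform give a hypersurface terminating centre datum

Route `ResolutionOfSingularities/WeightedInvariant`, crux `Theses.WeightedInvariant.HypersurfaceCentreConstruction`
(stmt-ResolutionOfSingularities-19897: `∀ p prime, Nonempty (HypersurfaceTerminatingCentreDatum p)`), door line
`local-engine`; CRUX-PLAN r1 §v6.2 of `res-L1-w43-plan-1` («PROVER'S CHOICE OF FORM: the ∃-form … may be typed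
instead or in addition (`nonempty_hypersurfaceTerminatingCentreDatum_of_finiteSequences`); both are packaging»)
and `res-L1-w43-tri-2` TRIAGE v3 O-v3.2 (TN-∃: «by classical choice the door is EQUIVALENT to the purely
existential statement ∃-DOOR_p: every good unresolved pair (k perfect of char p; Y smooth separated qc / k;
X ⊆ Y integral, locally principal, not regular) admits a FINITE sequence of centres, each satisfying
(iii-a)(iii-b′)(hom) on the CURRENT pair, whose iterated B₊-successors end in a regular strict transform»).
This file types the ∃-form and proves the direction ⇐ (∃-form ⇒ door datum):

* `IsAdmissibleCentre f X R` — a Rees algebra `R` on `Y` is an ADMISSIBLE centre for the pair `(f, X)`: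
  `(iii-a)` regular weighted centre, `(iii-b′)` support inside the image of the non-regular locus of `V(X)`
  (`singImage X`), `(hom)` every piece homogeneous on every graded affine chart of the pair (binder shape of
  `HypersurfaceTerminatingCentreDatum.centre_isHomogeneous`);
* `HypersurfacePair.AdmissiblyResolvable n P` — `P` is resolved by SOME admissible sequence of length `n`:
  `n = 0`: `V(X)` is regular; `n + 1`: there is an admissible centre `R` on `P`, a Rees filtration `R′` with
  the pieces of `R` whose global cobordant blow-up `B₊ → Y → Spec k` is smooth separated quasi-compact with
  locally principal, integral strict transform (the data `HypersurfacePair.Step` records), and the successor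
  pair is admissibly resolvable in `n` steps;
* `minLength f X` (least such `n`, `0` off hypersurface pairs / unresolvable pairs) and `seqCentre f X` (the
  first centre of a length-minimising sequence; the unit Rees algebra where there is none);
* `HypersurfaceTerminatingCentreDatum.ofFiniteSequences` / `nonempty_hypersurfaceTerminatingCentreDatum_of_finiteSequences`:
  if over every perfect field of characteristic `p` every SINGULAR hypersurface pair is admissibly resolvable in
  finitely many steps, then `Γ := Bool`, `inv := singRating`, `centre := seqCentre`, `Λ := ℕ`,
  `rank := minLength` is a hypersurface terminating centre datum — `(term)`: the Rees filtration with the pieces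
  of the first centre is unique (`reesFiltration_eq_of_ideal_eq`), so the successor along it is the second pair
  of the minimiser, resolvable in one step less.

So the door owes NO invariant, NO rank and NO canonicity: only, pair by pair, finite admissible sequences that
terminate.  The converse direction (door datum ⇒ ∃-form; needs the tower facts that the successor of a good
pair along an admissible centre is again good) is not in this file.  Nothing here is a claim about Hironaka's
problem; no `Nonempty` of anything is asserted unconditionally.
-/

noncomputable section

open CategoryTheory AlgebraicGeometry TopologicalSpace
open Literature.AlgebraicGeometry.Resolution

set_option linter.dupNamespace false -- mandated namespace of this single-conjunct summit

namespace Summit.ResolutionOfSingularities.ResolutionOfSingularities.Theorems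

/-! ## Admissible centres on a pair -/

/-- **Admissible centre for the pair `(f : Y → Spec k, X)`**: a Rees algebra `R` on `Y` with `(iii-a)` `R`
a regular weighted centre, `(iii-b′)` `supp R ⊆ singImage X` (under the non-regular locus of `V(X)`), and
`(hom)` for every affine open `W` and every `ℤʲ`-grading of `Γ(Y, W)` with the constants in degree `0` making
`X(W)` homogeneous, every piece `Rₙ(W)` is homogeneous — exactly the three constraints a
`HypersurfaceTerminatingCentreDatum` puts on its centre at a singular pair (tri-2 O-v3.2). [folklore] -/
def IsAdmissibleCentre {k : Type} [Field k] {Y : Scheme.{0}} (f : Y ⟶ Spec (.of k))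
    (X : Y.IdealSheafData) (R : ReesAlgebraData Y) : Prop :=
  R.IsRegularWeightedCentre ∧ R.support ⊆ singImage X ∧
    ∀ (j : ℕ) (W : Y.affineOpens) (𝒜 : (Fin j → ℤ) → AddSubgroup Γ(Y, W)) [GradedRing 𝒜],
      (∀ c : Γ(Spec (.of k), ⊤), f.appLE ⊤ W le_top c ∈ 𝒜 0) → (X.ideal W).IsHomogeneous 𝒜 →
      ∀ n : ℕ, ((R.piece n).ideal W).IsHomogeneous 𝒜

/-! ## Hypersurface pairs from their hypotheses -/

/-- The conjunction "`(f, X)` is a hypersurface pair": `f` smooth separated quasi-compact, `X` locally principal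
with integral `V(X)` (the hypotheses of `HypersurfacePair`, as a `Prop`). [folklore] -/
def IsHypersurfacePair {k : Type} [Field k] {Y : Scheme.{0}} (f : Y ⟶ Spec (.of k))
    (X : Y.IdealSheafData) : Prop :=
  Smooth f ∧ IsSeparated f ∧ QuasiCompact f ∧ IsLocallyPrincipal X ∧ IsIntegral X.subscheme

namespace HypersurfacePair

variable {k : Type} [Field k]

/-- The hypersurface pair `(Y, f, X)` assembled from the hypotheses `IsHypersurfacePair f X` (reducible, so
that its projections `Y`, `f`, `X` unfold under instance search). [folklore] -/
abbrev ofIs {Y : Scheme.{0}} (f : Y ⟶ Spec (.of k)) (X : Y.IdealSheafData) (h : IsHypersurfacePair f X) :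
    HypersurfacePair k :=
  @HypersurfacePair.mk k _ Y f h.1 h.2.1 h.2.2.1 X h.2.2.2.1 h.2.2.2.2

/-- `ofIs` has ambient `Y`. [folklore] -/
@[simp] theorem ofIs_Y {Y : Scheme.{0}} (f : Y ⟶ Spec (.of k)) (X : Y.IdealSheafData)
    (h : IsHypersurfacePair f X) : (ofIs f X h).Y = Y := rfl

/-- `ofIs` has structure morphism `f`. [folklore] -/
@[simp] theorem ofIs_f {Y : Scheme.{0}} (f : Y ⟶ Spec (.of k)) (X : Y.IdealSheafData)
    (h : IsHypersurfacePair f X) : (ofIs f X h).f = f := rfl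

/-- `ofIs` has ideal sheaf `X`. [folklore] -/
@[simp] theorem ofIs_X {Y : Scheme.{0}} (f : Y ⟶ Spec (.of k)) (X : Y.IdealSheafData)
    (h : IsHypersurfacePair f X) : (ofIs f X h).X = X := rfl

/-! ## Admissible resolvability in `n` steps -/

/-- **`P` is resolved by some ADMISSIBLE centre sequence of length `n`** (tri-2 O-v3.2's «finite sequence of
centres, each satisfying (iii-a)(iii-b′)(hom) on the CURRENT pair, whose iterated B₊-successors end in a
regular strict transform»): for `n = 0`, `V(X)` is regular; for `n + 1`, there are an admissible centre `R` on
`P`, a Rees filtration `R′` on `Y` with the pieces of `R` such that `B₊ = R′.plus → Y → Spec k` is smooth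
separated quasi-compact and the strict transform `σˢ(X)|_{B₊}` is locally principal with integral zero
locus, and the successor pair `(B₊, σˢ(X)|_{B₊})` is resolved by an admissible sequence of length `n`.
[folklore] -/
def AdmissiblyResolvable : ℕ → HypersurfacePair k → Prop
  | 0, P => Scheme.IsRegular P.X.subscheme
  | n + 1, P => ∃ R : ReesAlgebraData P.Y, IsAdmissibleCentre P.f P.X R ∧
      ∃ (R' : ReesFiltration P.Y) (_ : R'.ideal = R.piece)
        (hs : Smooth (R'.πPlus ≫ P.f)) (hsep : IsSeparated (R'.πPlus ≫ P.f))
        (hqc : QuasiCompact (R'.πPlus ≫ P.f)) (hlp : IsLocallyPrincipal (R'.strictTransformPlus P.X))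
        (hint : IsIntegral (R'.strictTransformPlus P.X).subscheme),
        AdmissiblyResolvable n
          (@HypersurfacePair.mk k _ R'.plus (R'.πPlus ≫ P.f) hs hsep hqc (R'.strictTransformPlus P.X)
            hlp hint)

/-- **`R` heads an admissible resolution of `P` of length `n + 1`**: `R` is an admissible centre on `P` and
the successor along (the Rees filtration with the pieces of) `R` is admissibly resolvable in `n` steps.
[folklore] -/
def IsHead (P : HypersurfacePair k) (n : ℕ) (R : ReesAlgebraData P.Y) : Prop :=
  IsAdmissibleCentre P.f P.X R ∧
    ∃ (R' : ReesFiltration P.Y) (_ : R'.ideal = R.piece)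
      (hs : Smooth (R'.πPlus ≫ P.f)) (hsep : IsSeparated (R'.πPlus ≫ P.f))
      (hqc : QuasiCompact (R'.πPlus ≫ P.f)) (hlp : IsLocallyPrincipal (R'.strictTransformPlus P.X))
      (hint : IsIntegral (R'.strictTransformPlus P.X).subscheme),
      AdmissiblyResolvable n
        (@HypersurfacePair.mk k _ R'.plus (R'.πPlus ≫ P.f) hs hsep hqc (R'.strictTransformPlus P.X)
          hlp hint)

/-- Length `0`: admissibly resolvable in no step iff `V(X)` is regular. [folklore] -/
theorem admissiblyResolvable_zero_iff (P : HypersurfacePair k) :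
    AdmissiblyResolvable 0 P ↔ Scheme.IsRegular P.X.subscheme := Iff.rfl

/-- Length `n + 1`: admissibly resolvable in `n + 1` steps iff some admissible centre heads a resolution of
length `n + 1`. [folklore] -/
theorem admissiblyResolvable_succ_iff (P : HypersurfacePair k) (n : ℕ) :
    AdmissiblyResolvable (n + 1) P ↔ ∃ R : ReesAlgebraData P.Y, IsHead P n R := Iff.rfl

/-- **`P` is admissibly resolvable** (in some finite number of steps). [folklore] -/
def Resolvable (P : HypersurfacePair k) : Prop :=
  ∃ n, AdmissiblyResolvable n P

end HypersurfacePair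

/-! ## The minimal length and the first centre of a minimiser -/

section MinLength

variable {k : Type} [Field k] {Y : Scheme.{0}} (f : Y ⟶ Spec (.of k)) (X : Y.IdealSheafData)

open scoped Classical in
/-- **Minimal length of an admissible resolution of the pair `(f, X)`** (`0` if `(f, X)` is not a hypersurface
pair or admits no admissible resolution). [folklore] -/
def minLength : ℕ :=
  if h : ∃ hP : IsHypersurfacePair f X, (HypersurfacePair.ofIs f X hP).Resolvable then Nat.find h.snd else 0

/-- The minimal length is at most the length of any admissible resolution. [folklore] -/
theorem minLength_le (hP : IsHypersurfacePair f X) {n : ℕ}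
    (h : HypersurfacePair.AdmissiblyResolvable n (HypersurfacePair.ofIs f X hP)) : minLength f X ≤ n := by
  classical
  have hex : ∃ hP : IsHypersurfacePair f X, (HypersurfacePair.ofIs f X hP).Resolvable := ⟨hP, n, h⟩
  rw [minLength, dif_pos hex]
  exact Nat.find_le h

/-- A resolvable hypersurface pair is admissibly resolvable in `minLength` steps. [folklore] -/
theorem admissiblyResolvable_minLength (hP : IsHypersurfacePair f X)
    (hres : (HypersurfacePair.ofIs f X hP).Resolvable) :
    HypersurfacePair.AdmissiblyResolvable (minLength f X) (HypersurfacePair.ofIs f X hP) := by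
  classical
  have hex : ∃ hP : IsHypersurfacePair f X, (HypersurfacePair.ofIs f X hP).Resolvable := ⟨hP, hres⟩
  rw [minLength, dif_pos hex]
  exact Nat.find_spec hex.snd

/-- The minimal length of a resolvable SINGULAR hypersurface pair is positive. [folklore] -/
theorem minLength_pos (hP : IsHypersurfacePair f X) (hres : (HypersurfacePair.ofIs f X hP).Resolvable)
    (hsing : ¬ Scheme.IsRegular X.subscheme) : 0 < minLength f X := by
  by_contra h0
  have h := admissiblyResolvable_minLength f X hP hres
  rw [Nat.eq_zero_of_not_pos h0, HypersurfacePair.admissiblyResolvable_zero_iff] at h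
  exact hsing h

/-- At a resolvable singular hypersurface pair some admissible centre heads a resolution of length
`minLength`. [folklore] -/
theorem exists_isHead_minLength (hP : IsHypersurfacePair f X)
    (hres : (HypersurfacePair.ofIs f X hP).Resolvable) (hsing : ¬ Scheme.IsRegular X.subscheme) :
    ∃ (n : ℕ) (R : ReesAlgebraData Y),
      HypersurfacePair.IsHead (HypersurfacePair.ofIs f X hP) n R ∧ n + 1 = minLength f X := by
  obtain ⟨n, hn⟩ : ∃ n, minLength f X = n + 1 :=
    Nat.exists_eq_add_one.mpr (minLength_pos f X hP hres hsing)
  have h := admissiblyResolvable_minLength f X hP hres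
  rw [hn, HypersurfacePair.admissiblyResolvable_succ_iff] at h
  obtain ⟨R, hR⟩ := h
  exact ⟨n, R, hR, hn.symm⟩

open scoped Classical in
/-- **The first centre of a length-minimising admissible resolution of `(f, X)`** (the unit Rees algebra if
`(f, X)` is not a hypersurface pair with a positive-length minimal admissible resolution). [folklore] -/
def seqCentre : ReesAlgebraData Y :=
  if h : ∃ (hP : IsHypersurfacePair f X) (n : ℕ) (R : ReesAlgebraData Y),
      HypersurfacePair.IsHead (HypersurfacePair.ofIs f X hP) n R ∧ n + 1 = minLength f X
  then h.snd.choose_spec.choose else ReesAlgebraData.unit Y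

/-- **Specification of `seqCentre` at a resolvable singular hypersurface pair**: it heads an admissible
resolution of minimal length. [folklore] -/
theorem seqCentre_spec (hP : IsHypersurfacePair f X) (hres : (HypersurfacePair.ofIs f X hP).Resolvable)
    (hsing : ¬ Scheme.IsRegular X.subscheme) :
    ∃ n : ℕ, HypersurfacePair.IsHead (HypersurfacePair.ofIs f X hP) n (seqCentre f X) ∧
      n + 1 = minLength f X := by
  classical
  have hex : ∃ (hP : IsHypersurfacePair f X) (n : ℕ) (R : ReesAlgebraData Y),
      HypersurfacePair.IsHead (HypersurfacePair.ofIs f X hP) n R ∧ n + 1 = minLength f X := by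
    obtain ⟨n, R, hR, hn⟩ := exists_isHead_minLength f X hP hres hsing
    exact ⟨hP, n, R, hR, hn⟩
  rw [seqCentre, dif_pos hex]
  exact ⟨hex.snd.choose, hex.snd.choose_spec.choose_spec⟩

end MinLength

/-! ## The datum of finite admissible sequences -/

namespace HypersurfaceTerminatingCentreDatum

variable {p : ℕ}

/-- **The ∃-form gives the door datum.**  If over every perfect field of characteristic `p` every SINGULAR
hypersurface pair admits a finite admissible centre sequence ending in a regular strict transform, then
`Γ := Bool`, `inv := singRating`, `centre := seqCentre` (first centre of a length-minimiser), `Λ := ℕ`,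
`rank := minLength` is a hypersurface terminating centre datum: `(ii)` is `isBot_singRating_iff`;
`(iii-a)`, `(iii-b′)`, `(hom)` are the admissibility of the first centre; `(term)`: the Rees filtration with
the pieces of the first centre is unique (`reesFiltration_eq_of_ideal_eq`), so the successor along it is the
minimiser's second pair, admissibly resolvable in one step less. [folklore] -/
def ofFiniteSequences
    (hseq : ∀ ⦃k : Type⦄ [Field k] [CharP k p] [PerfectField k] (P : HypersurfacePair k),
      ¬ Scheme.IsRegular P.X.subscheme → P.Resolvable) :
    HypersurfaceTerminatingCentreDatum p where
  Γ := Bool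
  inv := fun _ _ _ _ X y => CentreRankDatum.singRating X y
  centre := fun _ _ _ f X => seqCentre f X
  Λ := ℕ
  rank := fun _ _ _ f X => minLength f X
  isBot_inv_iff := fun _ _ _ _ _ _ _ _ _ X _ _ y => CentreRankDatum.isBot_singRating_iff X y
  isRegularWeightedCentre_centre := fun k _ _ _ _ f _ _ _ X hX hXi h => by
    have hP : IsHypersurfacePair f X := ⟨‹_›, ‹_›, ‹_›, hX, hXi⟩
    have hsing := (CentreRankDatum.exists_not_isBot_singRating_iff X).mp h
    obtain ⟨n, hhead, _⟩ := seqCentre_spec f X hP (hseq (HypersurfacePair.ofIs f X hP) hsing) hsing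
    exact hhead.1.1
  support_centre_subset := fun k _ _ _ _ f _ _ _ X hX hXi h y hy => by
    have hP : IsHypersurfacePair f X := ⟨‹_›, ‹_›, ‹_›, hX, hXi⟩
    have hsing := (CentreRankDatum.exists_not_isBot_singRating_iff X).mp h
    obtain ⟨n, hhead, _⟩ := seqCentre_spec f X hP (hseq (HypersurfacePair.ofIs f X hP) hsing) hsing
    exact (mem_singImage_iff_not_isBot_singRating X y).mp (hhead.1.2.1 hy)
  centre_isHomogeneous := fun k _ _ _ _ f _ _ _ X hX hXi h j W 𝒜 _ h0 hXhom n => by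
    have hP : IsHypersurfacePair f X := ⟨‹_›, ‹_›, ‹_›, hX, hXi⟩
    have hsing := (CentreRankDatum.exists_not_isBot_singRating_iff X).mp h
    obtain ⟨m, hhead, _⟩ := seqCentre_spec f X hP (hseq (HypersurfacePair.ofIs f X hP) hsing) hsing
    exact hhead.1.2.2 j W 𝒜 h0 hXhom n
  rank_lt := fun k _ _ _ _ f _ _ _ X hX hXi h R'' hR'' => by
    have hP : IsHypersurfacePair f X := ⟨‹_›, ‹_›, ‹_›, hX, hXi⟩
    have hsing := (CentreRankDatum.exists_not_isBot_singRating_iff X).mp h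
    obtain ⟨n, ⟨_, R', hR', hs, hsep, hqc, hlp, hint, hres'⟩, hn⟩ :=
      seqCentre_spec f X hP (hseq (HypersurfacePair.ofIs f X hP) hsing) hsing
    -- the Rees filtration with the pieces of the first centre is unique
    obtain rfl : R'' = R' := reesFiltration_eq_of_ideal_eq (hR''.trans hR'.symm)
    -- the successor along it is the minimiser's second pair, resolvable in `n` steps
    have hP' : IsHypersurfacePair (R''.πPlus ≫ f) (R''.strictTransformPlus X) := ⟨hs, hsep, hqc, hlp, hint⟩
    change minLength (R''.πPlus ≫ f) (R''.strictTransformPlus X) < minLength f X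
    calc minLength (R''.πPlus ≫ f) (R''.strictTransformPlus X) ≤ n := minLength_le _ _ hP' hres'
      _ < n + 1 := Nat.lt_succ_self n
      _ = minLength f X := hn

/-- The datum of finite sequences is centred by `seqCentre`. [folklore] -/
@[simp] theorem ofFiniteSequences_centre (hseq) {k : Type} [Field k] {Y : Scheme.{0}}
    (f : Y ⟶ Spec (.of k)) (X : Y.IdealSheafData) :
    (ofFiniteSequences (p := p) hseq).centre f X = seqCentre f X := rfl

/-- The datum of finite sequences is ranked by `minLength`. [folklore] -/
@[simp] theorem ofFiniteSequences_rank (hseq) {k : Type} [Field k] {Y : Scheme.{0}}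
    (f : Y ⟶ Spec (.of k)) (X : Y.IdealSheafData) :
    (ofFiniteSequences (p := p) hseq).rank f X = minLength f X := rfl

end HypersurfaceTerminatingCentreDatum

/-- **The ∃-form of the door (tri-2 TN-∃, direction ⇐): finite admissible centre sequences at every singular
hypersurface pair over every perfect field of characteristic `p` give a hypersurface terminating centre datum
in characteristic `p`** — no invariant, no rank, no canonicity across pairs is owed.  Witness:
`HypersurfaceTerminatingCentreDatum.ofFiniteSequences`. [folklore] -/
theorem nonempty_hypersurfaceTerminatingCentreDatum_of_finiteSequences (p : ℕ)
    (hseq : ∀ ⦃k : Type⦄ [Field k] [CharP k p] [PerfectField k] (P : HypersurfacePair k),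
      ¬ Scheme.IsRegular P.X.subscheme → P.Resolvable) :
    Nonempty (HypersurfaceTerminatingCentreDatum p) :=
  ⟨HypersurfaceTerminatingCentreDatum.ofFiniteSequences hseq⟩

end Summit.ResolutionOfSingularities.ResolutionOfSingularities.Theorems

end
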